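import Summits.QuantumFields.YangMills.Theorems.BalabanUVNodesN12TowerGuardsOfClass
import Literature.MathematicalPhysics.QuantumFieldTheory.Balaban1983to89.B15Prop1SliceDatumCurvatureUniform

/-!
# DAG node N12 [B15] — THE CHART-CURVATURE LETTER (R2) OF THE (β)-SPLIT's MULTIPLIER ROW, INHABITED PER HEIGHT FOR EVERY CONFIGURATION OF NODE 00's (2.12) CLASS:
# one `M₂ ≥ 0` per (instance, height) with `‖D²Φ₀(0)[p̂,p̂]‖ ≤ M₂·Σ_b‖p b‖²` for every `U₀ ∈ U_k({Ω_j(Z)}, εreg)`, every datum on its fibre, every slice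

[Balaban1985Variational] = «[15]», (2) p. 278, Sect. C (44)–(48) p. 285, (81)–(83) p. 290, Prop. 9 (190) p. 309; [Balaban1989LargeFieldII] = «[LF-II]», (1.12)–(1.13) p. 359;
[Balaban1988Convergent] = «[III]», (2.2) p. 255, (2.10)–(2.13) pp. 256–257; [Balaban1987RG1] (0.4) p. 253.

Cell `pub-ymgap`, HUMAN RULINGS D-0062 ∕ D-0149, lane owner `pub-ymgap-dag-n12-c` (g26, strategy s1).  Key K1⁹ `stmt-QuantumFields-27364`, `--kind proof --supports … --as helper`; count-neutral.
NEW leaf; CONSUMED BY NAME, nothing modified: the lane's `B15Prop1SliceDatumCurvatureUniform.exists_uniform_sliceDatum_curvatureLetter` (g26: one constant on a compact guarded family),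
`N12TowerGuardsOfClass.guardOn_towerRegion_of_plaqSmallOn_towerBox` (g24: plaquette-small on the tower box ⇒ guarded along the tower), dag-n12-w3's `boxPlaqs_subset_plaqsOf_topSeq_pred`
(the tower box lies in the class region one level down), ρ5b's `boxSide_mul_eta_sq_le`.

WHY.  dag-n12-w6's (M)-row producer `…N12MultiplierLetterOfClass` (INTENT-4, 2026-08-29) displays per base field ONE analytic letter, (R2) `hcurv`, whose constant `M₂` enters
`m := 8(d−1)·δ·B₁·M₂` — chosen BEFORE the base field in the (J0′) producer (p712371 ∕ V2 p717767 ∕ V3), hence needed UNIFORMLY per height.  THIS FILE supplies it: the set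
`T = {U | every plaquette of the tower box of every positive-level constrained bond (j, c) of 𝐁_k(Z) is ≤ ρ″∕(2(d−1)(6Lʲ−4))-small}` is CLOSED in the compact `SU(2)^{bonds}`, contains the class
([15] (2) at tolerance `εreg·η_{j−1}²` on the box, which lies in `Ω_{j−1}`'s plaquettes; the floor `12(d−1)L·εreg ≤ ρ″`), and every `U ∈ T` is (0.4)-guarded along every tower (strict
tolerance `ρ″∕((d−1)(6Lʲ−4))`, budget exactly `ρ″`); the Literature file gives one `M₂` on `T`.

CONTENTS (namespace `Summit.QuantumFields.YangMills.BalabanUVNodes.N12SliceDatumCurvatureOfClass`; theorems only — two private continuity lemmas and ONE public theorem; no `def`, no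
`instance`, no `sorry`).  ★★★ `exists_uniform_sliceDatum_curvatureLetter_of_class`.

HONEST FRAMING ∕ LOCATED.  Compactness + bookkeeping by name; `M₂` is an EXISTENCE constant per (instance, height) (U4 grade; print's volume-uniform `O(1)` of [15] (46) NOT claimed);
nothing of Bałaban's estimates asserted; count-neutral helper; N12 NOT discharged; K1⁹ NOT closed; counts unmoved; one finite 𝕋⁴ programme at fixed ε — R4 closes the conditional
finite-𝕋⁴ rung `BalabanLadder.UV` only; NOT continuum ∕ OS ∕ mass gap ∕ Clay.
-/

noncomputable section

open scoped BigOperators Matrix.Norms.L2Operator Topology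

namespace Summit.QuantumFields.YangMills.BalabanUVNodes.N12SliceDatumCurvatureOfClass

open Set Metric Filter
open Literature.MathematicalPhysics.QuantumFieldTheory.Balaban1983to89
open Literature.MathematicalPhysics.QuantumFieldTheory.Balaban1983to89.Node00 (SU coeField SmallBelow ConstrSet constrCard constrEnum avOfRecord regMSCoPOfRecord suppDomOfRecord topSeq Stage7Numerics)
open T4Continuum B15DeterminingSets GaugeField
open B14.Eq213MaximalDomains (side)
open B14.Eq213DetSet (Bj Bj_mid Bj_top maxDomT)
open B14.Eq22Determines (blockIter)
open B10Eq42TorusConstraint (bondsIn)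
open B15AveragingHolomorphic (iterMh)
open B15SU2ChartHolomorphic (expMulC logCoordC)
open B15Prop1AnalyticExtClause (cplxVec)
open B15Prop1ChartCalculusSU2 (E3)
open ExpMeanLog (expMeanLogSU)
open BlockAveraging (Small blockAvg)
open T4CubeChartGnomonic (SU2)
open T4AxialGaugeSmallField (boxPlaqs)
open T4ReflectionCone (three_le_L)
open B15Prop1SliceDatumCurvatureUniform (exists_uniform_sliceDatum_curvatureLetter)
open Summit.QuantumFields.YangMills.BalabanUVNodes.N12TowerGuardsOfClass (guardOn_towerRegion_of_plaqSmallOn_towerBox)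
open Summit.QuantumFields.YangMills.BalabanUVNodes.N12TowerProxiesOfClass (boxSide_mul_eta_sq_le)
open Summit.QuantumFields.YangMills.BalabanUVNodes.N12WindowNearRegionGeometry (boxPlaqs_subset_plaqsOf_topSeq_pred exists_word_endpoints)

variable {F : T4Family}

/-! ## §1  The plaquette letters are continuous; the closed plaquette-small set around the class is compact -/

/-- Plaquette variables are continuous in the configuration (finite products and inverses in `SU(2)`). [cite: Balaban1985Averaging, (9) p.19 (bookkeeping)] -/
private theorem continuous_plaqHol {P : Params} (q : Plaq P 0) : Continuous fun U : GaugeField P 0 SU2 => GaugeField.plaqHol U q := by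
  have hb : ∀ b : PBond P 0, Continuous fun U : GaugeField P 0 SU2 => U b := fun b => continuous_apply b
  unfold GaugeField.plaqHol
  exact (((hb _).mul (hb _)).mul (hb _).inv).mul (hb _).inv

/-- The plaquette letter `U ↦ |U(∂q) − 1|` is continuous. [cite: Balaban1985Variational, (2) p.278 (bookkeeping)] -/
private theorem continuous_dist1_plaqHol {P : Params} (q : Plaq P 0) : Continuous fun U : GaugeField P 0 SU2 => dist1 (GaugeField.plaqHol U q) := by
  have h : Continuous fun U : GaugeField P 0 SU2 => ‖((GaugeField.plaqHol U q : SU2) : Matrix (Fin 2) (Fin 2) ℂ) - 1‖ :=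
    ((continuous_subtype_val.comp (continuous_plaqHol q)).sub continuous_const).norm
  exact h

/-! ## §2  (R2) per height, for every configuration of NODE 00's (2.12) class -/

/-- ★★★ **THE CHART-CURVATURE LETTER (R2) OF THE (M)-ROW PRODUCER, INHABITED PER HEIGHT FOR EVERY (2.12)-CLASS CONFIGURATION.**  Once per instance `(Kt, k, Z, ν)` and height: the
standing rows `2 ≤ d`, `k + 1 ≤ m + K`, `4L ≤ M₁`, the cube divisibility, `0 ≤ εreg`, the radius letter `hsbU` at a POSITIVE radius `ρ″` and the floor `12(d−1)L·εreg ≤ ρ″` (twice the capstone's).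
CONCLUSION: ONE `M₂ ≥ 0` such that for EVERY `U₀ ∈ U_k({Ω_j(Z)}, εreg)` (no minimality needed), EVERY multi-scale datum `W` on whose fibre `U₀` lies, EVERY complex slice `S` and the slice
datum coordinates `Φ₀` by their formula, and every real slice field `p` (kernel hypothesis carried, unused): `‖D²Φ₀(0)[p̂,p̂]‖ ≤ M₂·Σ_b‖p b‖²` — dag-n12-w6's displayed `hcurv` VERBATIM.
Proof: `B15Prop1SliceDatumCurvatureUniform.exists_uniform_sliceDatum_curvatureLetter` on the CLOSED (hence compact, `SU(2)^{bonds}` is compact) set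
`T = {U | every plaquette of the tower box of every positive-level constrained bond of 𝐁_k(Z) is ≤ ρ″∕(2(d−1)(6Lʲ−4))-small}`: it contains the class ([15] (2) one level down on the box,
`boxPlaqs_subset_plaqsOf_topSeq_pred`, and the floor), and on it every configuration is (0.4)-guarded along every tower (`N12TowerGuardsOfClass.guardOn_towerRegion_of_plaqSmallOn_towerBox` at
tolerance `ρ″∕((d−1)(6Lʲ−4))`).  LOCATED: `M₂` is an EXISTENCE constant per (instance, height) (U4 grade) — print's volume-uniform `O(1)` of [15] (46) is NOT claimed.
[cite: Balaban1985Variational, (2) p.278, Sect. C (44)–(48) p.285, (81)–(83) p.290, Prop. 9 (190) p.309; Balaban1989LargeFieldII, (1.12)–(1.13) p.359; Balaban1988Convergent, (2.2) p.255, (2.10)–(2.13) pp.256–257; Balaban1987RG1, (0.4) p.253] -/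
theorem exists_uniform_sliceDatum_curvatureLetter_of_class (ν : Stage7Numerics) (Kt : ℕ) (hd : 2 ≤ (F.P Kt).d) {k : ℕ} (Z : Set (Site (F.P Kt) 0))
    (hkK : k + 1 ≤ (F.P Kt).m + (F.P Kt).K) (hM4 : 4 * (F.P Kt).L ≤ ν.M₁) (hdiv : side (F.P Kt).L ν.M₁ k ∣ (F.P Kt).sitesPerDir 0) (hε : 0 ≤ ν.εreg)
    {ρ'' : ℝ} (hρ : 0 < ρ'') (hsbU : ∀ V : GaugeField (F.P Kt) 0 SU2, ‖coeField V - 1‖ ≤ ρ'' → SmallBelow (avOfRecord F 2 Kt) k V)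
    (hερ : 12 * ((((F.P Kt).d - 1 : ℕ)) : ℝ) * (F.P Kt).L * ν.εreg ≤ ρ'') :
    ∃ M₂ : ℝ, 0 ≤ M₂ ∧ ∀ U₀ ∈ regMSCoPOfRecord F 2 ν Kt k (maxDomT ν.M₁ Z), ∀ W : MSField (F.P Kt) SU2,
      AgreeOn (Bj ν.M₁ Z k) (avgFamily (avOfRecord F 2 Kt) U₀) W →
      ∀ (S : Submodule ℂ (VecField (F.P Kt) 0 (EuclideanSpace ℂ (Fin 3)))) (Φ₀ : S → Fin (constrCard (Bj ν.M₁ Z k) k) → EuclideanSpace ℂ (Fin 3)),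
        (∀ (X : S) i, Φ₀ X i = logCoordC (star ((W ((constrEnum (Bj ν.M₁ Z k) k).symm i).1 ((constrEnum (Bj ν.M₁ Z k) k).symm i).2.1 : SU2) : Matrix (Fin 2) (Fin 2) ℂ) *
          iterMh ((constrEnum (Bj ν.M₁ Z k) k).symm i).1 (expMulC (X : VecField (F.P Kt) 0 (EuclideanSpace ℂ (Fin 3))) (coeField U₀)) ((constrEnum (Bj ν.M₁ Z k) k).symm i).2.1)) →
        ∀ (p : VecField (F.P Kt) 0 E3) (hp : cplxVec p ∈ S), fderiv ℂ Φ₀ 0 ⟨cplxVec p, hp⟩ = 0 →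
          ‖fderiv ℂ (fderiv ℂ Φ₀) 0 ⟨cplxVec p, hp⟩ ⟨cplxVec p, hp⟩‖ ≤ M₂ * ∑ b : PBond (F.P Kt) 0, ‖p b‖ ^ 2 := by
  have hk : k ≤ (F.P Kt).m + (F.P Kt).K := by omega
  have hM1 : 1 ≤ ν.M₁ := le_trans (by have := three_le_L (F.P Kt); omega) hM4
  have hd1 : (0 : ℝ) < ((((F.P Kt).d - 1 : ℕ)) : ℝ) := by
    have : 1 ≤ (F.P Kt).d - 1 := by omega
    exact_mod_cast this
  have hL1 : 1 ≤ (F.P Kt).L := (F.P Kt).L_pos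
  -- notation: the constrained bonds of `𝐁_k(Z)`, the tower boxes and the closed tolerance
  set 𝔹 : DetSet (F.P Kt) := Bj ν.M₁ Z k with h𝔹
  set J : Fin (constrCard 𝔹 k) → ℕ := fun i => (((constrEnum 𝔹 k).symm i).1 : ℕ) with hJ
  set lo : Fin (constrCard 𝔹 k) → Fin (F.P Kt).d → ℤ := fun i κ =>
    (((embIter (J i) ((constrEnum 𝔹 k).symm i).2.1.src) κ).val : ℤ) - ((3 * (F.P Kt).L ^ (J i) - 3 : ℕ) : ℤ) with hlo
  set hi : Fin (constrCard 𝔹 k) → Fin (F.P Kt).d → ℤ := fun i κ =>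
    (((embIter (J i) ((constrEnum 𝔹 k).symm i).2.1.src) κ).val : ℤ) + ((3 * (F.P Kt).L ^ (J i) - 3 : ℕ) : ℤ) + 2 with hhi
  set B : ℕ → ℝ := fun j => ρ'' / (2 * ((((F.P Kt).d - 1 : ℕ)) : ℝ) * ((6 * (F.P Kt).L ^ j - 4 : ℕ) : ℕ)) with hB
  have hside : ∀ j, (0 : ℝ) < ((6 * (F.P Kt).L ^ j - 4 : ℕ) : ℕ) := fun j => by
    have hq : 1 ≤ (F.P Kt).L ^ j := Nat.one_le_pow _ _ hL1
    have : 2 ≤ 6 * (F.P Kt).L ^ j - 4 := by omega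
    exact_mod_cast (by omega : 0 < 6 * (F.P Kt).L ^ j - 4)
  have hBpos : ∀ j, 0 < B j := fun j => by
    simp only [hB]
    exact div_pos hρ (by have := hside j; positivity)
  -- the closed plaquette-small set
  set T : Set (GaugeField (F.P Kt) 0 SU2) := {U | ∀ i : Fin (constrCard 𝔹 k), 1 ≤ J i →
    ∀ q ∈ (boxPlaqs (lo i) (hi i) : Set (Plaq (F.P Kt) 0)), dist1 (GaugeField.plaqHol U q) ≤ B (J i)} with hT
  have hTclosed : IsClosed T := by
    have hrepr : T = ⋂ i : Fin (constrCard 𝔹 k), ⋂ (_ : 1 ≤ J i), ⋂ q ∈ (boxPlaqs (lo i) (hi i) : Set (Plaq (F.P Kt) 0)),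
        {U : GaugeField (F.P Kt) 0 SU2 | dist1 (GaugeField.plaqHol U q) ≤ B (J i)} := by
      ext U
      simp only [hT, Set.mem_setOf_eq, Set.mem_iInter]
    rw [hrepr]
    exact isClosed_iInter fun i => isClosed_iInter fun _ => isClosed_biInter fun q _ =>
      isClosed_le (continuous_dist1_plaqHol q) continuous_const
  haveI : CompactSpace (GaugeField (F.P Kt) 0 SU2) := inferInstanceAs (CompactSpace (PBond (F.P Kt) 0 → SU2))
  have hTcomp : IsCompact T := hTclosed.isCompact
  -- every configuration of `T` is guarded along every tower
  have hgT : ∀ U ∈ T, ∀ i : Fin (constrCard 𝔹 k), ∀ j', j' < (((constrEnum 𝔹 k).symm i).1 : ℕ) → ∀ c' : PBond (F.P Kt) (j' + 1),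
      c' ∈ bondsIn (j' + 1) (blockIter (((constrEnum 𝔹 k).symm i).1 : ℕ) ⁻¹'
        ({((constrEnum 𝔹 k).symm i).2.1.src, ((constrEnum 𝔹 k).symm i).2.1.tgt} : Set (Site (F.P Kt) ((constrEnum 𝔹 k).symm i).1))) →
        Small expMeanLogSU (Averaging.iter (fun j => blockAvg (P := F.P Kt) (j := j) expMeanLogSU) j' U) c' := by
    intro U hU i
    rcases Nat.eq_zero_or_pos (J i) with h0 | hpos
    · intro j' hj'
      exact absurd hj' (by simp only [hJ] at h0; omega)
    · have hj1 : 1 ≤ J i := hpos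
      have hjk : J i ≤ k := Nat.lt_succ_iff.1 ((constrEnum 𝔹 k).symm i).1.2
      have hsmall : PlaqSmallOn (boxPlaqs (lo i) (hi i) : Set (Plaq (F.P Kt) 0)) (2 * B (J i)) U := fun q hq =>
        lt_of_le_of_lt (hU i hj1 q hq) (by have := hBpos (J i); linarith)
      have hbudget : ((((F.P Kt).d - 1 : ℕ)) : ℝ) * ((6 * (F.P Kt).L ^ (J i) - 4 : ℕ) : ℕ) * (2 * B (J i)) ≤ ρ'' := by
        refine le_of_eq ?_
        simp only [hB]
        have h1 := hside (J i)
        field_simp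
      exact guardOn_towerRegion_of_plaqSmallOn_towerBox (F := F) (N := 2) Kt hkK hj1 hjk ((constrEnum 𝔹 k).symm i).2.1 subset_rfl
        (by have := hBpos (J i); positivity) hsmall hsbU hbudget
  -- one constant for the compact guarded family
  obtain ⟨M₂, hM₂, hR2⟩ := exists_uniform_sliceDatum_curvatureLetter 𝔹 k hk hTcomp hgT
  refine ⟨M₂, hM₂, fun U₀ hU₀ W hW S Φ₀ hΦ₀ p hp hker => hR2 U₀ ?_ W hW S Φ₀ hΦ₀ p hp hker⟩
  -- the class lies in `T`: [15] (2) one level down on the tower box, and the floor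
  intro i hj1 q hq
  have hjk : J i ≤ k := Nat.lt_succ_iff.1 ((constrEnum 𝔹 k).symm i).1.2
  set c := ((constrEnum 𝔹 k).symm i).2.1 with hc
  have hcmem : c ∈ bondsOf (Bj ν.M₁ Z k (J i)) := ((constrEnum 𝔹 k).symm i).2.2
  -- the end of `c` in `Γ_j ⊆ Ω_j^{(j)}` and the straight word to `c₋`
  obtain ⟨y, hy, hyΩ⟩ : ∃ y : Site (F.P Kt) (J i), (y = c.src ∨ y = c.tgt) ∧ embIter (J i) y ∈ maxDomT ν.M₁ Z (J i) := by
    have hsub : Bj ν.M₁ Z k (J i) ⊆ pts (J i) (maxDomT ν.M₁ Z (J i)) := by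
      rcases lt_or_eq_of_le hjk with hlt | heq
      · rw [Bj_mid hj1 hlt]; exact fun _ h => h.1
      · rw [heq, Bj_top]
    rcases hcmem with h | h
    · exact ⟨c.src, Or.inl rfl, mem_pts.1 (hsub h)⟩
    · exact ⟨c.tgt, Or.inr rfl, mem_pts.1 (hsub h)⟩
  obtain ⟨w₀, hw₀len, hw₀⟩ := exists_word_endpoints c hy (Or.inl rfl : c.src = c.src ∨ c.src = c.tgt)
  have hfitR : (F.P Kt).L ^ (J i) + (3 * (F.P Kt).L ^ (J i) - 3) + 3 ≤ (F.P Kt).L ^ (J i - 1) * ν.M₁ := by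
    obtain ⟨i', hi'⟩ : ∃ i', J i = i' + 1 := ⟨J i - 1, by omega⟩
    rw [hi', Nat.add_sub_cancel]
    have h4A : 4 * (F.P Kt).L ^ (i' + 1) ≤ (F.P Kt).L ^ i' * ν.M₁ :=
      calc 4 * (F.P Kt).L ^ (i' + 1) = (F.P Kt).L ^ i' * (4 * (F.P Kt).L) := by ring
        _ ≤ (F.P Kt).L ^ i' * ν.M₁ := Nat.mul_le_mul_left _ hM4
    have hq : 1 ≤ (F.P Kt).L ^ (i' + 1) := Nat.one_le_pow _ _ hL1
    omega
  have hplaqs : (boxPlaqs (lo i) (hi i) : Set (Plaq (F.P Kt) 0)) ⊆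
      B8Eq17ClassAkV1.plaqsOf (topSeq (suppDomOfRecord F ν Kt (maxDomT ν.M₁ Z)) (maxDomT ν.M₁ Z) (J i - 1)) :=
    boxPlaqs_subset_plaqsOf_topSeq_pred ν Kt hj1 hjk hM1 hdiv Z hyΩ hw₀ hw₀len hfitR
  have hcls : PlaqSmallOn (B8Eq17ClassAkV1.plaqsOf (topSeq (suppDomOfRecord F ν Kt (maxDomT ν.M₁ Z)) (maxDomT ν.M₁ Z) (J i - 1)))
      (ν.εreg * (F.P Kt).eta (J i - 1) ^ 2) U₀ := hU₀.1 (J i - 1) (by omega)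
  have hlt := hcls q (hplaqs hq)
  refine hlt.le.trans ?_
  -- the floor: `εreg·η_{j−1}² ≤ ρ″∕(2(d−1)(6Lʲ−4))`
  have hside' := boxSide_mul_eta_sq_le (F.P Kt) hj1
  have hs := hside (J i)
  simp only [hB]
  rw [le_div_iff₀ (by positivity)]
  have hcast : (((6 * (F.P Kt).L ^ (J i) - 4 : ℕ) : ℕ) : ℝ) = ((6 * (F.P Kt).L ^ (J i) - 4 : ℕ) : ℝ) := rfl
  calc ν.εreg * (F.P Kt).eta (J i - 1) ^ 2 * (2 * ((((F.P Kt).d - 1 : ℕ)) : ℝ) * ((6 * (F.P Kt).L ^ (J i) - 4 : ℕ) : ℕ))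
      = 2 * ((((F.P Kt).d - 1 : ℕ)) : ℝ) * ((((6 * (F.P Kt).L ^ (J i) - 4 : ℕ) : ℝ) * (F.P Kt).eta (J i - 1) ^ 2) * ν.εreg) := by rw [hcast]; ring
    _ ≤ 2 * ((((F.P Kt).d - 1 : ℕ)) : ℝ) * ((6 * ((F.P Kt).L : ℝ)) * ν.εreg) := by gcongr
    _ = 12 * ((((F.P Kt).d - 1 : ℕ)) : ℝ) * (F.P Kt).L * ν.εreg := by ring
    _ ≤ ρ'' := hερ

end Summit.QuantumFields.YangMills.BalabanUVNodes.N12SliceDatumCurvatureOfClass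

end
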